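import Mathlib

/-!
# Route HardyPointSink — crux `NoHardyTypeIAncient`, line `birth`: weak-`L³` pinning

Stub `stub_weakL3Pinning` of the registered skeleton of line `birth` for the crux
`Summit.NavierStokesRegularity.NavierStokesRegularity.Theses.HardyPointSink.NoHardyTypeIAncient`
(item stmt-NavierStokesRegularity-7980).

The line transfers a weak-`L³` (Lorentz `L^{3,∞}`) bound from a slice `u(τ_k)` of a duality-form
ancient solution to the slice `U(τ_k)` of its continuous Oseen representative; the two slices agree
only up to a spatial constant `c` (`u(τ_k) = U(τ_k) + c` a.e.), while `U(τ_k)` has a finite Hardy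
integral `∫ |U|² / |x| < ∞`. This file is the pure measure-theoretic fact that the weak-`L³` bound
pins `c = 0`:

* `stub_weakL3Pinning`: if `f = g + c` a.e., `g` is a.e.-strongly measurable with
  `∫⁻ ‖g‖ₑ² / ‖x‖ₑ < ∞`, and `s³ · |{s < |f|}| ≤ M < ∞` for all `s > 0`, then `c = 0`.

Proof: if `c ≠ 0`, put `s = |c| / 2`. Off a null set, every point of the ball `B_R` either has
`|g| ≥ s` or `|f| = |g + c| > s`; Markov's inequality for the Hardy integrand (which is
`≥ s² / R` on `B_R ∩ {|g| ≥ s}`) bounds the first part by `H R / s²`, the weak-`L³` bound makes the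
second part of finite measure `V`, so `R³ |B_1| ≤ V + H R / s²` for every `R > 0`, which fails for
`R` large. (The boundedness hypothesis `‖g‖ ≤ C` of the registered signature is not needed.)

Mathlib only (`mul_meas_ge_le_lintegral₀`, `Measure.addHaar_ball_of_pos`). [folklore]
-/

open MeasureTheory Set Function Filter TopologicalSpace
open scoped ENNReal NNReal Topology RealInnerProductSpace

set_option linter.dupNamespace false -- nested layout Summit.<S>.<Sub>, Sub = S (D-0017)

namespace Summit.NavierStokesRegularity.NavierStokesRegularity.Theorems

/-- Real-variable bookkeeping for `stub_weakL3Pinning`: with `R = 1 + (V + H / s²) / v` the two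
bounds `R³ v ≤ V + b` (volume of the ball against the two covering pieces) and `(s² / R) b ≤ H`
(Markov for the Hardy integrand) are incompatible, since
`R³ v = R² (v + V + H / s²) > V + R H / s²`. [folklore] -/
theorem weakL3Pinning_real_absurd {s v V H b : ℝ} (hs : 0 < s) (hv : 0 < v) (hV : 0 ≤ V)
    (hH : 0 ≤ H)
    (h1 : (1 + (V + H / s ^ 2) / v) ^ 3 * v ≤ V + b)
    (h2 : s ^ 2 / (1 + (V + H / s ^ 2) / v) * b ≤ H) : False := by
  set K : ℝ := H / s ^ 2 with hK_def
  have hK : 0 ≤ K := div_nonneg hH (pow_nonneg hs.le 2)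
  set R : ℝ := 1 + (V + K) / v with hR_def
  have hR1 : 1 ≤ R := by
    have : 0 ≤ (V + K) / v := div_nonneg (add_nonneg hV hK) hv.le
    linarith
  have hR : 0 < R := by linarith
  have hRv : R * v = v + V + K := by
    rw [hR_def]; field_simp; ring
  have hcube : R ^ 3 * v = R ^ 2 * v + R ^ 2 * V + R ^ 2 * K := by
    have : R ^ 3 * v = R ^ 2 * (R * v) := by ring
    rw [this, hRv]; ring
  -- from `h2`: `b ≤ K R`
  have hb : b ≤ K * R := by
    rw [div_mul_eq_mul_div, div_le_iff₀ hR] at h2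
    rw [hK_def, div_mul_eq_mul_div, le_div_iff₀ (pow_pos hs 2)]
    linarith
  nlinarith [mul_pos (pow_pos hR 2) hv,
    mul_nonneg (mul_nonneg (sub_nonneg.2 hR1) (by linarith : (0 : ℝ) ≤ R + 1)) hV,
    mul_nonneg (mul_nonneg hR.le (sub_nonneg.2 hR1)) hK]

/-- The covering behind `stub_weakL3Pinning`: if `s = ‖c‖ / 2`, every point `x` (of any set, here
the ball `B_R`) either has `s < ‖f x‖`, or violates `f x = g x + c`, or has `s ≤ ‖g x‖` — because
`f x = g x + c` and `‖g x‖ < s` force `‖f x‖ ≥ ‖c‖ - ‖g x‖ > s`. [folklore] -/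
theorem weakL3Pinning_ball_subset (f g : EuclideanSpace ℝ (Fin 3) → EuclideanSpace ℝ (Fin 3))
    (c : EuclideanSpace ℝ (Fin 3)) (R : ℝ) :
    Metric.ball (0 : EuclideanSpace ℝ (Fin 3)) R ⊆
      ({x | ‖c‖ / 2 < ‖f x‖} ∪ {x | f x ≠ g x + c}) ∪
        (Metric.ball (0 : EuclideanSpace ℝ (Fin 3)) R ∩ {x | ‖c‖ / 2 ≤ ‖g x‖}) := by
  intro x hx
  by_cases hfx : f x = g x + c
  · by_cases hgx : ‖c‖ / 2 ≤ ‖g x‖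
    · exact Or.inr ⟨hx, hgx⟩
    · refine Or.inl (Or.inl ?_)
      show ‖c‖ / 2 < ‖f x‖
      have hle : ‖c‖ ≤ ‖g x + c‖ + ‖g x‖ := by
        calc ‖c‖ = ‖(g x + c) - g x‖ := by rw [add_sub_cancel_left]
          _ ≤ ‖g x + c‖ + ‖g x‖ := norm_sub_le _ _
      rw [hfx]
      linarith [not_le.1 hgx]
  · exact Or.inl (Or.inr hfx)

/-- **Weak-`L³` pinning of the spatial constant** (stub `stub_weakL3Pinning` of line `birth` of the
crux `NoHardyTypeIAncient`). If `f = g + c` a.e. on `ℝ³` with `g` a.e.-strongly measurable and of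
finite Hardy integral `∫⁻ ‖g‖ₑ² / ‖x‖ₑ < ∞`, and `f` has a finite weak-`L³` quasi-norm
(`s³ |{s < |f|}| ≤ M < ∞` for all `s > 0`), then `c = 0`. If not, with `s = |c| / 2` the covering
`weakL3Pinning_ball_subset`, Markov's inequality for the Hardy integrand on `B_R ∩ {|g| ≥ s}` and
`|B_R| = R³ |B_1|` give `R³ |B_1| ≤ V + H R / s²` for every `R > 0`, absurd by
`weakL3Pinning_real_absurd`. (The bound `‖g‖ ≤ C` is not used.) [folklore] -/
theorem stub_weakL3Pinning :
    ∀ (f g : EuclideanSpace ℝ (Fin 3) → EuclideanSpace ℝ (Fin 3)) (c : EuclideanSpace ℝ (Fin 3))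
      (M : ℝ≥0∞) (C : ℝ),
      M < ⊤ →
      AEStronglyMeasurable g volume →
      (∀ x, ‖g x‖ ≤ C) →
      (∫⁻ x, ‖g x‖ₑ ^ 2 / ‖x‖ₑ) < ⊤ →
      (f =ᵐ[volume] fun x => g x + c) →
      (∀ s : ℝ, 0 < s →
        ENNReal.ofReal s ^ 3 * volume {x : EuclideanSpace ℝ (Fin 3) | s < ‖f x‖} ≤ M) →
      c = 0 := by
  intro f g c M C hM hg _ hH hfg hweak
  by_contra hc
  have hcpos : 0 < ‖c‖ := norm_pos_iff.2 hc
  have hs : 0 < ‖c‖ / 2 := half_pos hcpos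
  -- the weak-L³ level set at height `s = ‖c‖ / 2` has finite measure `V`
  have hV : volume {x : EuclideanSpace ℝ (Fin 3) | ‖c‖ / 2 < ‖f x‖} < ⊤ := by
    refine ENNReal.lt_top_of_mul_ne_top_right (a := ENNReal.ofReal (‖c‖ / 2) ^ 3) ?_ ?_
    · exact ((hweak _ hs).trans_lt hM).ne
    · exact pow_ne_zero _ (ENNReal.ofReal_pos.2 hs).ne'
  -- the exceptional set of the a.e. identity is null
  have hnull : volume {x : EuclideanSpace ℝ (Fin 3) | f x ≠ g x + c} = 0 := ae_iff.1 hfg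
  -- the unit ball has positive finite volume `v`
  have hvpos : 0 < (volume (Metric.ball (0 : EuclideanSpace ℝ (Fin 3)) 1)).toReal :=
    ENNReal.toReal_pos (Metric.measure_ball_pos volume _ one_pos).ne' measure_ball_lt_top.ne
  -- the Hardy integrand is a.e.-measurable
  have hφ : AEMeasurable (fun x : EuclideanSpace ℝ (Fin 3) => ‖g x‖ₑ ^ 2 / ‖x‖ₑ) volume :=
    (hg.enorm.pow_const 2).div measurable_enorm.aemeasurable
  -- abbreviations (real numbers)
  set V : ℝ≥0∞ := volume {x : EuclideanSpace ℝ (Fin 3) | ‖c‖ / 2 < ‖f x‖} with hV_def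
  set H : ℝ≥0∞ := ∫⁻ x, ‖g x‖ₑ ^ 2 / ‖x‖ₑ with hH_def
  set v : ℝ≥0∞ := volume (Metric.ball (0 : EuclideanSpace ℝ (Fin 3)) 1) with hv_def
  set s : ℝ := ‖c‖ / 2 with hs_def
  -- the radius
  set R : ℝ := 1 + (V.toReal + H.toReal / s ^ 2) / v.toReal with hR_def
  have hR : 0 < R := by
    have : 0 ≤ (V.toReal + H.toReal / s ^ 2) / v.toReal := by positivity
    linarith
  -- the bad piece of the ball
  set B : Set (EuclideanSpace ℝ (Fin 3)) :=
    Metric.ball (0 : EuclideanSpace ℝ (Fin 3)) R ∩ {x | s ≤ ‖g x‖} with hB_def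
  have hBfin : volume B ≠ ⊤ :=
    ((measure_mono inter_subset_left).trans_lt measure_ball_lt_top).ne
  -- (1) volume of the ball against the covering
  have hball :
      volume (Metric.ball (0 : EuclideanSpace ℝ (Fin 3)) R) = ENNReal.ofReal (R ^ 3) * v := by
    rw [hv_def, Measure.addHaar_ball_of_pos volume 0 hR, finrank_euclideanSpace_fin]
  have h1 : ENNReal.ofReal (R ^ 3) * v ≤ V + volume B := by
    rw [← hball]
    calc volume (Metric.ball (0 : EuclideanSpace ℝ (Fin 3)) R)
        ≤ volume (({x | s < ‖f x‖} ∪ {x | f x ≠ g x + c}) ∪ B) :=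
          measure_mono (weakL3Pinning_ball_subset f g c R)
      _ ≤ volume ({x | s < ‖f x‖} ∪ {x | f x ≠ g x + c}) + volume B := measure_union_le _ _
      _ ≤ volume {x | s < ‖f x‖} + volume {x | f x ≠ g x + c} + volume B := by
          gcongr; exact measure_union_le _ _
      _ = V + volume B := by rw [hnull, add_zero]
  -- (2) Markov for the Hardy integrand on `B`
  have h2 : ENNReal.ofReal s ^ 2 / ENNReal.ofReal R * volume B ≤ H := by
    have hBsub : B ⊆ {x | ENNReal.ofReal s ^ 2 / ENNReal.ofReal R ≤ ‖g x‖ₑ ^ 2 / ‖x‖ₑ} := by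
      rintro x ⟨hx, hgx⟩
      have hx' : ‖x‖ₑ ≤ ENNReal.ofReal R := by
        rw [← ofReal_norm]
        exact ENNReal.ofReal_le_ofReal (mem_ball_zero_iff.1 hx).le
      have hg' : ENNReal.ofReal s ≤ ‖g x‖ₑ := by
        rw [← ofReal_norm]
        exact ENNReal.ofReal_le_ofReal hgx
      exact ENNReal.div_le_div (by gcongr) hx'
    calc ENNReal.ofReal s ^ 2 / ENNReal.ofReal R * volume B
        ≤ ENNReal.ofReal s ^ 2 / ENNReal.ofReal R *
            volume {x | ENNReal.ofReal s ^ 2 / ENNReal.ofReal R ≤ ‖g x‖ₑ ^ 2 / ‖x‖ₑ} := by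
          gcongr
      _ ≤ H := mul_meas_ge_le_lintegral₀ hφ _
  -- pass to real numbers
  have h1' : R ^ 3 * v.toReal ≤ V.toReal + (volume B).toReal := by
    have := ENNReal.toReal_mono (ENNReal.add_ne_top.2 ⟨hV.ne, hBfin⟩) h1
    rwa [ENNReal.toReal_mul, ENNReal.toReal_ofReal (pow_nonneg hR.le 3),
      ENNReal.toReal_add hV.ne hBfin] at this
  have h2' : s ^ 2 / R * (volume B).toReal ≤ H.toReal := by
    have := ENNReal.toReal_mono hH.ne h2
    rwa [ENNReal.toReal_mul, ENNReal.toReal_div, ENNReal.toReal_pow, ENNReal.toReal_ofReal hs.le,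
      ENNReal.toReal_ofReal hR.le] at this
  exact weakL3Pinning_real_absurd hs hvpos ENNReal.toReal_nonneg ENNReal.toReal_nonneg h1' h2'

end Summit.NavierStokesRegularity.NavierStokesRegularity.Theorems
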